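import Literature.Probability.LatticeModels.BrickworkMap
import Literature.Probability.LatticeModels.GaussianPairingBoundCouplings
import Literature.Probability.LatticeModels.IsingThermodynamics
import Literature.Probability.LatticeModels.LatticeGraphProofs
import HarnessLib

/-!
# The critical Ising correlator on the twisted free box (twist wall of screw dislocations)

Topic `Literature/Probability/LatticeModels`. Definitions requested by route VolterraWard of
`Summits/CriticalPhenomena/Ising3DConformalLimit` (items 7037–7040 inline them as `let F … let C …
let D …`; this file names them VERBATIM, so that `TwistFluxConservation`, `CoreTransparency`,
`WallCrossingContinuity`, `WallDecay` can be restated over the names by `Iff.rfl`):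

* (imported from `BrickworkMap.lean`, item `defn-brickworkMap`) `brickworkMap W M : Site 3 → Site 3`
  — the area-preserving "brickwork" bijection `F(p) = (p₀ − Mk, p₁ + Mj, p₂)`, `k = ⌊p₁/W⌋`,
  `j = ⌊(p₀ − Mk)/W⌋`: two perpendicular lattice shears of period `W` and Burgers number `M`, the
  discretised rotation of the plane by `ε = M/W` realised by two perpendicular periodic arrays of
  screw dislocations — the dislocation model of a low-angle TWIST boundary (Cai–Nix 2016, §14.2: a
  single screw array is a shear wall with a long-range `σ_yz`, eqs. (14.20)–(14.24); two
  perpendicular arrays rotate the upper crystal, Frank's formula `θ ≈ b/s`, eq. (14.25)).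
* `twistCouplings N W M A : ↥(box 3 N) → ↥(box 3 N) → ℝ` — the pair couplings of the TWISTED FREE
  BOX: `β_c(3)/2` (`PairIsing` double-counts ordered pairs) on (i) planar nearest-neighbour pairs in
  the layers `z ≤ A`, (ii) pairs of a layer `z > A` whose `F`-images are planar nearest neighbours
  (the upper crystal relabelled so that vertical bonds are straight), (iii) vertical
  nearest-neighbour pairs; `0` otherwise.
* `twistCorr N W M A n y` — the Gibbs average (`PairIsing.avg`, Newman's pair-interaction model on a
  finite set) of the spin monomial `∏ᵢ σ_{yᵢ}` in the twisted free box, with the convention `0` if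
  some `yᵢ ∉ box 3 N`.
* `twistOddResponse N W M A n y = twistCorr … M … − twistCorr … (−M) …` — the `ε`-odd
  (chirality-odd) response.

## API proved here

* `brickworkMap_planar_eq_iff` (`F` acts on the first two coordinates, injectively).
* `twistAdj` (the bond relation as a `Prop`) with `twistCouplings_eq_ite`; symmetry, vanishing
  diagonal and nonnegativity of the couplings (the hypotheses of GKS / Griffiths comparison through
  `PairIsing.avg_eq_gksExpect`); `twistAdj_zero_right_iff` (`M = 0`: the nearest-neighbour graph of
  `ℤ³`), and the GRAPH-ISOMORPHISM facts behind the transport identity of `WallDecay`: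
  `twistAdj_iff_of_le` (lower end in a layer `≤ A`: plain adjacency),
  `twistAdj_iff_of_lt` (an end in a layer `> A`: adjacency of the `F`-images),
  `twistAdj_iff_of_le_of_lt` (across the wall: the straight vertical bond).
* `PairIsing.avg_adj_eq_isingExpect_free` — the pair-interaction average with couplings
  `β/2 · 𝟙{x ∼ y}` on `↥Λ` IS the free-boundary zero-field Ising expectation `⟨·⟩^∅_{Λ;β,0}` of the
  tree (`isingExpect`, Friedli–Velenik §3.1 eq. (3.8)); hence `twistCorr_zero_right` :
  `twistCorr N W 0 A n y = ⟨∏ᵢ σ_{yᵢ}⟩^∅_{box 3 N; β_c(3), 0}` (the untwisted box is the plain free box).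
* `PairIsing.avg_comp_equiv` — transport of `PairIsing.avg` along a bijection of the index set.
* `twistCorr_nonneg` (GKS I), `twistCorr_eq_zero_of_not_mem`, `abs_twistCorr_le_one`,
  `twistOddResponse_neg_M`, `twistOddResponse_zero_right`.

## References

* W. Cai, W. D. Nix, *Imperfections in Crystalline Solids*, CUP 2016, §14.2 (low angle twist
  boundaries = two perpendicular screw dislocation arrays; eq. (14.25) `θ ≈ b/s`) [CaiNix2016]
  (read: PDF pp. 456–459).
* S. Friedli, Y. Velenik, *Statistical Mechanics of Lattice Systems*, CUP 2017, §3.1 eq. (3.8)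
  [FriedliVelenik2017].
* C. M. Newman, Z. Wahrsch. verw. Gebiete 33 (1975) 75–93, eq. (1.1) [Newman1975] (`PairIsing.avg`).

## Design / not here

The definitions are kept syntactically identical to the route's inlined terms (including the
integer floor division `Int` `/`, for which `(-7)/2 = -4`, and the junk value `W = 0 ⇒ F = id` from
`x / 0 = 0`), at the single inverse temperature `β_c(3)` the route uses. Not here: the infinite-volume
(`N → ∞`) limit of `twistCorr` (GKS monotonicity), the identification free = plus state at `β_c(3)`
(Aizenman–Duminil-Copin–Sidoravicius 2015 / Raoufi 2020), and the card's "bicrystal" graph — the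
transport identity is provided at the level of the bond relation (`twistAdj_iff_of_lt` with
`brickworkEquiv` of `BrickworkMap.lean` and `PairIsing.avg_comp_equiv`).
-/

noncomputable section

open Finset MeasureTheory

namespace Literature.Probability.LatticeModels

/-! ### The brickwork map acts on the first two coordinates (complement to `BrickworkMap.lean`) -/

/-- The planar part of `F` is injective: `F(p)₀ = F(q)₀ ∧ F(p)₁ = F(q)₁ ↔ p₀ = q₀ ∧ p₁ = q₁`
(`F` acts on the first two coordinates only). [folklore] -/
theorem brickworkMap_planar_eq_iff (W : ℕ) (M : ℤ) (p q : Site 3) :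
    (brickworkMap W M p 0 = brickworkMap W M q 0 ∧ brickworkMap W M p 1 = brickworkMap W M q 1) ↔
      (p 0 = q 0 ∧ p 1 = q 1) := by
  constructor
  · rintro ⟨h0, h1⟩
    -- compare `p` with the point `q' = (q₀, q₁, p₂)`, which has the same image as `p`
    set q' : Site 3 := fun i => if i = 2 then p 2 else q i with hq'
    have himg : brickworkMap W M p = brickworkMap W M q' := by
      funext i
      fin_cases i
      · simpa [hq', brickworkMap] using h0
      · simpa [hq', brickworkMap] using h1
      · simp [hq', brickworkMap]
    have hpq := brickworkMap_injective W M himg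
    exact ⟨by simpa [hq'] using congrFun hpq 0, by simpa [hq'] using congrFun hpq 1⟩
  · rintro ⟨h0, h1⟩
    rw [brickworkMap_apply_zero, brickworkMap_apply_zero, brickworkMap_apply_one, brickworkMap_apply_one, h0, h1]
    exact ⟨rfl, rfl⟩

/-! ### Adjacency in `ℤ³` by layers -/

/-- Adjacency in `ℤ³` split by the third coordinate: a planar nearest-neighbour pair in one layer,
or a straight vertical bond. [folklore] -/
theorem zdGraph_three_adj_iff (x y : Site 3) :
    (zdGraph 3).Adj x y ↔
      (x 2 = y 2 ∧ |x 0 - y 0| + |x 1 - y 1| = 1) ∨ (x 0 = y 0 ∧ x 1 = y 1 ∧ |x 2 - y 2| = 1) := by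
  rw [zdGraph_adj_iff_norm_holds, Fin.sum_univ_three]
  have h0 := abs_nonneg (x 0 - y 0); have h0' := abs_choice (x 0 - y 0)
  have h1 := abs_nonneg (x 1 - y 1); have h1' := abs_choice (x 1 - y 1)
  have h2 := abs_nonneg (x 2 - y 2); have h2' := abs_choice (x 2 - y 2)
  generalize |x 0 - y 0| = a at h0 h0' ⊢
  generalize |x 1 - y 1| = b at h1 h1' ⊢
  generalize |x 2 - y 2| = c at h2 h2' ⊢
  omega

/-! ### The twisted bond relation and the couplings -/

/-- The bond relation of the twisted graph with the wall between layers `A` and `A + 1`: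
(i) planar nearest neighbours in a layer `z ≤ A`, (ii) pairs of a layer `z > A` whose `F`-images are
planar nearest neighbours, (iii) straight vertical nearest neighbours. [cite: CaiNix2016, §14.2.2] -/
def twistAdj (W : ℕ) (M A : ℤ) (x y : Site 3) : Prop :=
  (x 2 = y 2 ∧ x 2 ≤ A ∧ |x 0 - y 0| + |x 1 - y 1| = 1) ∨
    (x 2 = y 2 ∧ A < x 2 ∧
      |brickworkMap W M x 0 - brickworkMap W M y 0| + |brickworkMap W M x 1 - brickworkMap W M y 1| = 1) ∨
    (x 0 = y 0 ∧ x 1 = y 1 ∧ |x 2 - y 2| = 1)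

/-- The twisted bond relation is decidable (it is a Boolean combination of integer (in)equalities).
[folklore] -/
instance twistAdj.instDecidable (W : ℕ) (M A : ℤ) (x y : Site 3) : Decidable (twistAdj W M A x y) := by
  unfold twistAdj; infer_instance

/-- The **couplings of the twisted free box** `box 3 N` at `β_c(3)`: `β_c(3)/2` on the bonds of
`twistAdj W M A` (halved because `PairIsing` sums over ordered pairs), `0` otherwise; verbatim the
coupling matrix inlined in items 7037–7040 of route VolterraWard. [cite: CaiNix2016, §14.2.2] -/
def twistCouplings (N W : ℕ) (M A : ℤ) (a b : ↥(box 3 N)) : ℝ :=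
  if (a.1 2 = b.1 2 ∧ a.1 2 ≤ A ∧ |a.1 0 - b.1 0| + |a.1 1 - b.1 1| = 1) ∨
      (a.1 2 = b.1 2 ∧ A < a.1 2 ∧
        |brickworkMap W M a.1 0 - brickworkMap W M b.1 0| +
          |brickworkMap W M a.1 1 - brickworkMap W M b.1 1| = 1) ∨
      (a.1 0 = b.1 0 ∧ a.1 1 = b.1 1 ∧ |a.1 2 - b.1 2| = 1)
  then criticalBeta 3 / 2 else 0

/-- `twistCouplings` is `β_c(3)/2 · 𝟙{twistAdj}` (definitional). [folklore] -/
theorem twistCouplings_eq_ite (N W : ℕ) (M A : ℤ) (a b : ↥(box 3 N)) :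
    twistCouplings N W M A a b = if twistAdj W M A a.1 b.1 then criticalBeta 3 / 2 else 0 := rfl

/-- The twisted bond relation is symmetric. [folklore] -/
theorem twistAdj_symm {W : ℕ} {M A : ℤ} {x y : Site 3} (h : twistAdj W M A x y) : twistAdj W M A y x := by
  unfold twistAdj at h ⊢
  rw [abs_sub_comm (y 0), abs_sub_comm (y 1), abs_sub_comm (y 2), abs_sub_comm (brickworkMap W M y 0),
    abs_sub_comm (brickworkMap W M y 1)]
  rcases h with ⟨h1, h2, h3⟩ | ⟨h1, h2, h3⟩ | ⟨h1, h2, h3⟩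
  · exact Or.inl ⟨h1.symm, h1 ▸ h2, h3⟩
  · exact Or.inr (Or.inl ⟨h1.symm, h1 ▸ h2, h3⟩)
  · exact Or.inr (Or.inr ⟨h1.symm, h2.symm, h3⟩)

/-- The twisted bond relation is symmetric (iff form). [folklore] -/
theorem twistAdj_comm (W : ℕ) (M A : ℤ) (x y : Site 3) : twistAdj W M A x y ↔ twistAdj W M A y x :=
  ⟨twistAdj_symm, twistAdj_symm⟩

/-- No loops: `¬ twistAdj x x`. [folklore] -/
theorem twistAdj_irrefl (W : ℕ) (M A : ℤ) (x : Site 3) : ¬ twistAdj W M A x x := by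
  unfold twistAdj; simp

/-- Zero Burgers number: the twisted bond relation is the nearest-neighbour relation of `ℤ³`
(whatever the wall height `A` and block `W`). [folklore] -/
theorem twistAdj_zero_right_iff (W : ℕ) (A : ℤ) (x y : Site 3) :
    twistAdj W 0 A x y ↔ (zdGraph 3).Adj x y := by
  rw [zdGraph_three_adj_iff, twistAdj]
  simp only [brickworkMap_zero]
  have := le_or_gt (x 2) A
  constructor
  · rintro (⟨h1, -, h3⟩ | ⟨h1, -, h3⟩ | h) <;> [exact Or.inl ⟨h1, h3⟩; exact Or.inl ⟨h1, h3⟩; exact Or.inr h]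
  · rintro (⟨h1, h3⟩ | h)
    · rcases this with h2 | h2 <;> [exact Or.inl ⟨h1, h2, h3⟩; exact Or.inr (Or.inl ⟨h1, h2, h3⟩)]
    · exact Or.inr (Or.inr h)

/-- **Below the wall** the twisted graph is `ℤ³`: for `x₂ ≤ A` (and any `y`), `twistAdj x y ↔ x ∼ y`.
[folklore] -/
theorem twistAdj_iff_of_le {W : ℕ} {M A : ℤ} {x y : Site 3} (hx : x 2 ≤ A) :
    twistAdj W M A x y ↔ (zdGraph 3).Adj x y := by
  rw [zdGraph_three_adj_iff, twistAdj]
  constructor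
  · rintro (⟨h1, -, h3⟩ | ⟨-, h2, -⟩ | h) <;> [exact Or.inl ⟨h1, h3⟩; exact absurd hx (not_le.mpr h2); exact Or.inr h]
  · rintro (⟨h1, h3⟩ | h) <;> [exact Or.inl ⟨h1, hx, h3⟩; exact Or.inr (Or.inr h)]

/-- **Above the wall** the twisted graph is the pull-back of `ℤ³` by `F × id` (the transport
identity behind `WallDecay`): for `A < x₂` (and any `y`), `twistAdj x y ↔ F x ∼ F y`. [folklore] -/
theorem twistAdj_iff_of_lt {W : ℕ} {M A : ℤ} {x y : Site 3} (hx : A < x 2) :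
    twistAdj W M A x y ↔ (zdGraph 3).Adj (brickworkMap W M x) (brickworkMap W M y) := by
  rw [zdGraph_three_adj_iff, twistAdj, brickworkMap_apply_two, brickworkMap_apply_two]
  have hpl := brickworkMap_planar_eq_iff W M x y
  constructor
  · rintro (⟨-, h2, -⟩ | ⟨h1, -, h3⟩ | ⟨h0, h1, h2⟩)
    · exact absurd hx (not_lt.mpr h2)
    · exact Or.inl ⟨h1, h3⟩
    · exact Or.inr ⟨(hpl.2 ⟨h0, h1⟩).1, (hpl.2 ⟨h0, h1⟩).2, h2⟩
  · rintro (⟨h1, h3⟩ | ⟨h0, h1, h2⟩)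
    · exact Or.inr (Or.inl ⟨h1, hx, h3⟩)
    · exact Or.inr (Or.inr ⟨(hpl.1 ⟨h0, h1⟩).1, (hpl.1 ⟨h0, h1⟩).2, h2⟩)

/-- **Across the wall** only the straight vertical bond survives: for `x₂ ≤ A < y₂`,
`twistAdj x y ↔ (x₀, x₁) = (y₀, y₁) ∧ y₂ = x₂ + 1` (so `x₂ = A`, `y₂ = A + 1`). [folklore] -/
theorem twistAdj_iff_of_le_of_lt {W : ℕ} {M A : ℤ} {x y : Site 3} (hx : x 2 ≤ A) (hy : A < y 2) :
    twistAdj W M A x y ↔ x 0 = y 0 ∧ x 1 = y 1 ∧ y 2 = x 2 + 1 := by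
  rw [twistAdj]
  have hne : x 2 ≠ y 2 := fun h => (hx.trans_lt (h ▸ hy)).false.elim
  have habs : |x 2 - y 2| = 1 ↔ y 2 = x 2 + 1 := by
    rw [abs_sub_comm, abs_eq zero_le_one]; omega
  rw [habs]
  constructor
  · rintro (⟨h1, -, -⟩ | ⟨h1, -, -⟩ | h) <;> [exact absurd h1 hne; exact absurd h1 hne; exact h]
  · exact fun h => Or.inr (Or.inr h)

/-- The couplings are symmetric. [folklore] -/
theorem twistCouplings_symm (N W : ℕ) (M A : ℤ) (a b : ↥(box 3 N)) :
    twistCouplings N W M A a b = twistCouplings N W M A b a := by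
  rw [twistCouplings_eq_ite, twistCouplings_eq_ite, if_congr (twistAdj_comm W M A a.1 b.1) rfl rfl]

/-- The couplings vanish on the diagonal. [folklore] -/
theorem twistCouplings_self (N W : ℕ) (M A : ℤ) (a : ↥(box 3 N)) : twistCouplings N W M A a a = 0 := by
  rw [twistCouplings_eq_ite, if_neg (twistAdj_irrefl W M A a.1)]

/-- The couplings are nonnegative (ferromagnetic), since `β_c(3) ≥ 0`. [folklore] -/
theorem twistCouplings_nonneg (N W : ℕ) (M A : ℤ) (a b : ↥(box 3 N)) : 0 ≤ twistCouplings N W M A a b := by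
  rw [twistCouplings_eq_ite]
  split_ifs
  · exact div_nonneg (criticalBeta_nonneg 3) zero_le_two
  · exact le_rfl

/-- Zero Burgers number: the couplings are `β_c(3)/2 · 𝟙{x ∼ y}`, the (ordered-pair) nearest-neighbour
couplings of the plain box. [folklore] -/
theorem twistCouplings_zero_right (N W : ℕ) (A : ℤ) (a b : ↥(box 3 N)) :
    twistCouplings N W 0 A a b = if (zdGraph 3).Adj a.1 b.1 then criticalBeta 3 / 2 else 0 := by
  rw [twistCouplings_eq_ite, if_congr (twistAdj_zero_right_iff W A a.1 b.1) rfl rfl]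

/-! ### The twisted correlator and its odd response -/

/-- The **critical Ising correlator on the twisted free box**: the Gibbs average, for the pair
couplings `twistCouplings N W M A` (free boundary condition, zero field, `β = β_c(3)`), of the spin
monomial `∏ᵢ σ_{yᵢ}`, with the convention `0` when some `yᵢ ∉ box 3 N`; verbatim the `C` inlined in
items 7037–7040 of route VolterraWard. [cite: CaiNix2016, §14.2.2] -/
def twistCorr (N W : ℕ) (M A : ℤ) (n : ℕ) (y : Fin n → Site 3) : ℝ :=
  PairIsing.avg (twistCouplings N W M A)
    (fun s => ∏ i, if h : y i ∈ box 3 N then spinAt (⟨y i, h⟩ : ↥(box 3 N)) s else 0)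

/-- The **`ε`-odd (chirality-odd) response** of the twisted correlator: twist `M` minus twist `−M`;
verbatim the `D` inlined in items 7037, 7039, 7040 of route VolterraWard. [cite: CaiNix2016, §14.2.2] -/
def twistOddResponse (N W : ℕ) (M A : ℤ) (n : ℕ) (y : Fin n → Site 3) : ℝ :=
  twistCorr N W M A n y - twistCorr N W (-M) A n y

/-- **Syntactic bridge**: the route's inlined `let F …; let C …` term is `twistCorr` (by `rfl`), so
the four lattice cruxes restate over the named definitions by `Iff.rfl`. [folklore] -/
theorem twistCorr_eq_inline :
    (let F : ℕ → ℤ → Site 3 → Site 3 := fun W M p i =>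
        if i = 0 then p 0 - M * (p 1 / (W : ℤ))
        else if i = 1 then p 1 + M * ((p 0 - M * (p 1 / (W : ℤ))) / (W : ℤ)) else p 2
      let C : (N W : ℕ) → (M A : ℤ) → (n : ℕ) → (Fin n → Site 3) → ℝ := fun N W M A _n y =>
        PairIsing.avg
          (fun a b : ↥(box 3 N) =>
            if (a.1 2 = b.1 2 ∧ a.1 2 ≤ A ∧ |a.1 0 - b.1 0| + |a.1 1 - b.1 1| = 1) ∨
                (a.1 2 = b.1 2 ∧ A < a.1 2 ∧
                  |F W M a.1 0 - F W M b.1 0| + |F W M a.1 1 - F W M b.1 1| = 1) ∨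
                (a.1 0 = b.1 0 ∧ a.1 1 = b.1 1 ∧ |a.1 2 - b.1 2| = 1)
            then criticalBeta 3 / 2 else 0)
          (fun s => ∏ i, if h : y i ∈ box 3 N then spinAt (⟨y i, h⟩ : ↥(box 3 N)) s else 0)
      C) = twistCorr := rfl

/-- The odd response is odd in the Burgers number. [folklore] -/
theorem twistOddResponse_neg_M (N W : ℕ) (M A : ℤ) (n : ℕ) (y : Fin n → Site 3) :
    twistOddResponse N W (-M) A n y = -twistOddResponse N W M A n y := by
  simp [twistOddResponse, neg_neg]

/-- No twist, no odd response. [folklore] -/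
@[simp] theorem twistOddResponse_zero_right (N W : ℕ) (A : ℤ) (n : ℕ) (y : Fin n → Site 3) :
    twistOddResponse N W 0 A n y = 0 := by
  simp [twistOddResponse]

/-- The convention `0` outside the box: if some `yᵢ ∉ box 3 N` then `twistCorr … y = 0`. [folklore] -/
theorem twistCorr_eq_zero_of_not_mem {N : ℕ} (W : ℕ) (M A : ℤ) {n : ℕ} {y : Fin n → Site 3} {i : Fin n}
    (hi : y i ∉ box 3 N) : twistCorr N W M A n y = 0 := by
  have h0 : (fun s : SpinConfig ↥(box 3 N) =>
      ∏ j, (if h : y j ∈ box 3 N then spinAt (⟨y j, h⟩ : ↥(box 3 N)) s else 0)) = fun _ => 0 := by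
    funext s
    exact Finset.prod_eq_zero (Finset.mem_univ i) (by rw [dif_neg hi])
  rw [twistCorr, h0, PairIsing.avg_const]

/-- `|twistCorr| ≤ 1` (an average of a product of spins or `0`). [folklore] -/
theorem abs_twistCorr_le_one (N W : ℕ) (M A : ℤ) (n : ℕ) (y : Fin n → Site 3) :
    |twistCorr N W M A n y| ≤ 1 := by
  rw [twistCorr, PairIsing.avg_def, abs_div, abs_of_pos (PairIsing.sum_weight_pos _),
    div_le_one (PairIsing.sum_weight_pos _)]
  refine (Finset.abs_sum_le_sum_abs _ _).trans (Finset.sum_le_sum fun s _ => ?_)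
  rw [abs_mul, abs_of_pos (PairIsing.weight_pos _ _)]
  refine mul_le_of_le_one_left (PairIsing.weight_pos _ _).le ?_
  rw [Finset.abs_prod]
  refine Finset.prod_le_one (fun i _ => abs_nonneg _) fun i _ => ?_
  split_ifs
  · exact (abs_spinAt _ _).le
  · simp

/-- `∏ᵢ σ_{vᵢ} = σ_B` with `B` the set of odd-multiplicity vertices of `v` (`σ_x² = 1`); a local copy
of the bookkeeping lemma `spinMonomial_eq_spinProduct_monomialSupport` of `PoissonDelaunayIsing`,
kept out of this file's imports. [folklore] -/
private theorem spinMonomial_eq_spinProduct_loc {V : Type*} [DecidableEq V] {n : ℕ} (v : Fin n → V) :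
    spinMonomial v = spinProduct ((Finset.univ.image v).filter fun p =>
      Odd (Finset.univ.filter fun i => v i = p).card) := by
  classical
  funext s
  unfold spinMonomial spinProduct
  rw [Finset.prod_comp (s := Finset.univ) (f := fun x => spinAt x s) (g := v), Finset.prod_filter]
  refine Finset.prod_congr rfl fun p _ => ?_
  rcases spinAt_eq_one_or_eq_neg_one p s with h1 | h1
  · simp [h1]
  · rw [h1]
    rcases Nat.even_or_odd (Finset.univ.filter fun i => v i = p).card with he | ho
    · rw [if_neg (Nat.not_odd_iff_even.2 he), he.neg_one_pow]
    · rw [if_pos ho, ho.neg_one_pow]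

/-- **GKS I on the twisted box**: `twistCorr N W M A n y ≥ 0` (the couplings are ferromagnetic; inside
the box the observable is a spin product `σ_B`, outside the value is `0`).
[cite: FriedliVelenik2017, Thm. 3.49, eq. (3.54)] -/
theorem twistCorr_nonneg (N W : ℕ) (M A : ℤ) (n : ℕ) (y : Fin n → Site 3) : 0 ≤ twistCorr N W M A n y := by
  by_cases hy : ∀ i, y i ∈ box 3 N
  · have hobs : (fun s : SpinConfig ↥(box 3 N) =>
        ∏ i, (if h : y i ∈ box 3 N then spinAt (⟨y i, h⟩ : ↥(box 3 N)) s else 0)) =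
        spinMonomial (fun i => (⟨y i, hy i⟩ : ↥(box 3 N))) := by
      funext s
      exact Finset.prod_congr rfl fun i _ => by rw [dif_pos (hy i)]
    rw [twistCorr, hobs, spinMonomial_eq_spinProduct_loc]
    exact PairIsing.avg_spinProduct_nonneg (twistCouplings_nonneg N W M A) _
  · obtain ⟨i, hi⟩ := not_forall.1 hy
    rw [twistCorr_eq_zero_of_not_mem W M A hi]

/-! ### `PairIsing.avg` with nearest-neighbour couplings is the free Ising expectation -/

namespace PairIsing

section Transport

variable {ι κ : Type*} [Fintype ι] [DecidableEq ι] [Fintype κ] [DecidableEq κ]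

/-- **Transport of the pair-interaction average along a bijection of the index set**:
relabelling sites by `e : ι ≃ κ` (couplings pulled back, observables pushed forward) does not
change Gibbs averages. [folklore] -/
theorem avg_comp_equiv (e : ι ≃ κ) (c : κ → κ → ℝ) (f : SpinConfig κ → ℝ) :
    avg (fun a b => c (e a) (e b)) (fun s => f (s ∘ e.symm)) = avg c f := by
  have hw : ∀ s : SpinConfig ι, weight (fun a b => c (e a) (e b)) s = weight c (s ∘ e.symm) := by
    intro s
    rw [weight, weight]
    congr 1
    refine Fintype.sum_equiv e _ _ fun a => ?_
    refine Fintype.sum_equiv e _ _ fun b => ?_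
    simp [spinAt]
  have harr : ∀ s : SpinConfig ι, (e.arrowCongr (Equiv.refl ℤˣ)) s = s ∘ e.symm := fun s => rfl
  have hn : ∑ s : SpinConfig ι, f (s ∘ e.symm) * weight (fun a b => c (e a) (e b)) s =
      ∑ t : SpinConfig κ, f t * weight c t :=
    Fintype.sum_equiv (e.arrowCongr (Equiv.refl ℤˣ)) _ _ fun s => by rw [harr, hw]
  have hd : ∑ s : SpinConfig ι, weight (fun a b => c (e a) (e b)) s = ∑ t : SpinConfig κ, weight c t :=
    Fintype.sum_equiv (e.arrowCongr (Equiv.refl ℤˣ)) _ _ fun s => by rw [harr, hw]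
  rw [avg_def, avg_def, hn, hd]

end Transport

section Free

variable {V : Type*} [DecidableEq V] (G : SimpleGraph V) [DecidableRel G.Adj] [G.LocallyFinite]

/-- Ordered adjacent pairs versus edges (a local copy of the bookkeeping lemma of
`MeanFieldDifferentialInequality`, kept out of this file's imports). [folklore] -/
private theorem sum_adj_eq_sum_edgesIn_loc (Λ : Finset V) (f : V → V → ℝ) :
    ∑ x ∈ Λ, ∑ y ∈ Λ.filter (G.Adj x), f x y =
      ∑ e ∈ edgesIn G Λ, Sym2.lift ⟨fun x y => f x y + f y x, fun _ _ => add_comm _ _⟩ e := by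
  set D := (Λ ×ˢ Λ).filter (fun p : V × V => G.Adj p.1 p.2) with hD
  have hL : ∑ x ∈ Λ, ∑ y ∈ Λ.filter (G.Adj x), f x y = ∑ p ∈ D, f p.1 p.2 := by
    rw [hD, sum_filter, sum_product]
    refine sum_congr rfl fun x _ => ?_
    rw [sum_filter]
  have hmaps : ∀ p ∈ D, s(p.1, p.2) ∈ edgesIn G Λ := by
    intro p hp
    rw [hD, mem_filter, mem_product] at hp
    refine mem_edgesIn_iff.2 ⟨(SimpleGraph.mem_edgeSet G).2 hp.2, fun v hv => ?_⟩
    rcases Sym2.mem_iff.1 hv with rfl | rfl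
    · exact hp.1.1
    · exact hp.1.2
  rw [hL, ← sum_fiberwise_of_maps_to hmaps]
  refine sum_congr rfl fun e he => ?_
  induction e using Sym2.ind with
  | _ x y =>
    obtain ⟨hadj, hmem⟩ := mem_edgesIn_iff.1 he
    have hadj' : G.Adj x y := (SimpleGraph.mem_edgeSet G).1 hadj
    have hxy : x ≠ y := G.ne_of_adj hadj'
    have hfib : D.filter (fun p : V × V => s(p.1, p.2) = s(x, y)) = {(x, y), (y, x)} := by
      ext p
      simp only [hD, mem_filter, mem_product, mem_insert, mem_singleton, Sym2.eq_iff]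
      constructor
      · rintro ⟨-, ⟨h1, h2⟩ | ⟨h1, h2⟩⟩
        · left; exact Prod.ext h1 h2
        · right; exact Prod.ext h1 h2
      · rintro (rfl | rfl)
        · exact ⟨⟨⟨hmem x (Sym2.mem_mk_left x y), hmem y (Sym2.mem_mk_right x y)⟩, hadj'⟩, Or.inl ⟨rfl, rfl⟩⟩
        · exact ⟨⟨⟨hmem y (Sym2.mem_mk_right x y), hmem x (Sym2.mem_mk_left x y)⟩, hadj'.symm⟩, Or.inr ⟨rfl, rfl⟩⟩
    rw [hfib, sum_pair (fun h => hxy (Prod.ext_iff.1 h).1), Sym2.lift_mk]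

/-- **The pair-interaction weight with couplings `β/2 · 𝟙{x ∼ y}` on `↥Λ` is the free zero-field
Ising Boltzmann weight `e^{β ∑_{e ∈ ℰ_Λ} σ_e}`** (each edge is two ordered pairs).
[cite: FriedliVelenik2017, §3.1, eqs. (3.2), (3.7)] -/
theorem weight_adj_eq_isingWeight (Λ : Finset V) (β : ℝ) (τ : SpinConfig ↥Λ) :
    weight (fun a b : ↥Λ => if G.Adj a b then β / 2 else 0) τ = isingWeight G Λ β 0 .free τ := by
  rw [weight, isingWeight]
  congr 1
  simp only [isingHamiltonian, interactionEdges_free, zero_mul, sub_zero, mul_neg, neg_mul, neg_neg]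
  set σ : SpinConfig V := glue Λ τ .free with hσ
  have hs : ∀ a : ↥Λ, spinAt a τ = spinAt (a : V) σ := by
    intro a; simp [spinAt, hσ]
  simp_rw [hs]
  set g : V → V → ℝ := fun x y => (if G.Adj x y then β / 2 else 0) * (spinAt x σ * spinAt y σ) with hg
  calc ∑ a : ↥Λ, ∑ b : ↥Λ, g a b = ∑ a : ↥Λ, ∑ y ∈ Λ, g a y :=
        Finset.sum_congr rfl fun a _ => Finset.sum_coe_sort Λ (g a)
    _ = ∑ x ∈ Λ, ∑ y ∈ Λ, g x y := Finset.sum_coe_sort Λ (fun x => ∑ y ∈ Λ, g x y)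
    _ = ∑ x ∈ Λ, ∑ y ∈ Λ.filter (G.Adj x), β / 2 * (spinAt x σ * spinAt y σ) := by
        refine Finset.sum_congr rfl fun x _ => ?_
        rw [Finset.sum_filter]
        refine Finset.sum_congr rfl fun y _ => ?_
        simp only [hg]
        split_ifs <;> simp
    _ = ∑ e ∈ edgesIn G Λ, β * bondSpin σ e := by
        rw [sum_adj_eq_sum_edgesIn_loc G Λ]
        refine Finset.sum_congr rfl fun e _ => ?_
        induction e using Sym2.ind with
        | _ x y => rw [Sym2.lift_mk, bondSpin_mk]; ring
    _ = β * ∑ e ∈ edgesIn G Λ, bondSpin σ e := (Finset.mul_sum _ _ _).symm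

/-- **`PairIsing.avg` with couplings `β/2 · 𝟙{x ∼ y}` on `↥Λ` is the free-boundary, zero-field Ising
expectation `⟨f⟩^∅_{Λ;β,0}` of the tree** (observables of the spins in `Λ` read through the
restriction `σ ↦ σ|_Λ`). [cite: FriedliVelenik2017, §3.1, eq. (3.8)] -/
theorem avg_adj_eq_isingExpect_free (Λ : Finset V) (β : ℝ) (f : SpinConfig ↥Λ → ℝ) :
    avg (fun a b : ↥Λ => if G.Adj a b then β / 2 else 0) f =
      isingExpect G Λ β 0 .free (fun σ => f (fun a => σ a)) := by
  have hF : Measurable (fun σ : SpinConfig V => f (fun a : ↥Λ => σ a)) :=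
    (measurable_of_finite f).comp (measurable_pi_lambda _ fun a => measurable_pi_apply _)
  rw [avg, isingExpect, integral_isingMeasure G Λ β 0 .free hF, isingPartitionFunction]
  have hglue : ∀ τ : SpinConfig ↥Λ, (fun a : ↥Λ => glue Λ τ .free a) = τ := fun τ =>
    funext fun a => by simp
  simp_rw [hglue, weight_adj_eq_isingWeight G Λ β, mul_comm (f _)]

end Free

end PairIsing

/-- **The untwisted box is the plain free box**: for `M = 0` (any wall height `A`, any block `W`)
and insertions inside the box, `twistCorr N W 0 A n y = ⟨∏ᵢ σ_{yᵢ}⟩^∅_{box 3 N; β_c(3), 0}`, the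
free-boundary zero-field critical Ising expectation of the spin monomial on `box 3 N ⊆ ℤ³`.
[cite: FriedliVelenik2017, §3.1, eq. (3.8)] -/
theorem twistCorr_zero_right {N : ℕ} (W : ℕ) (A : ℤ) {n : ℕ} {y : Fin n → Site 3}
    (hy : ∀ i, y i ∈ box 3 N) :
    twistCorr N W 0 A n y = isingExpect (zdGraph 3) (box 3 N) (criticalBeta 3) 0 .free (spinMonomial y) := by
  have hc : twistCouplings N W 0 A = fun a b : ↥(box 3 N) =>
      if (zdGraph 3).Adj a b then criticalBeta 3 / 2 else 0 :=
    funext fun a => funext fun b => twistCouplings_zero_right N W A a b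
  rw [twistCorr, hc, PairIsing.avg_adj_eq_isingExpect_free]
  congr 1
  funext σ
  simp only [spinMonomial]
  refine Finset.prod_congr rfl fun i _ => ?_
  rw [dif_pos (hy i)]
  rfl

end Literature.Probability.LatticeModels
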